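import Literature.Computability.AlgebraicComplexity.InterfaceMatMulTerms
import Literature.Computability.AlgebraicComplexity.MultinomialEntropy
import HarnessLib

/-!
# Thm. 6.1 of Vassilevska Williams–Xu–Xu–Zhou 2024: the size `M` of the matrix multiplication terms
in entropy form — proved

Topic `Literature/Computability/AlgebraicComplexity`.  `InterfaceMatMulTerms.lean` proves the
structural part of Theorem 6.1 of Vassilevska Williams–Xu–Xu–Zhou (SODA 2024, arXiv:2307.07970, §6):
a term `T_{i,j,0}^{⊗n}[γ_X, γ_Y, γ_Z, ε]` is isomorphic to `⟨1, M, 1⟩` (`vxxz2024_thm61_iso`), and at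
`ε = 0` with `γ_X = k/n` integral, `M = binom(n; k) · q^{∑_σ k(σ) #1's(σ)}` exactly
(`vxxz2024_thm61_card`).  This file adds the printed form of `M`,
"`M = 2^{n_t (H(γ_X^{(t)}) ± o_{1/ε}(1)) ± o(n)} · q^{n_t ∑_σ γ_X^{(t)}(σ) ∑_p [σ_p = 1]}`", at `ε = 0`
(where the `o_{1/ε}` term is absent) with Lemma 3.3's explicit `o(n)`:

* `vxxz2024_thm61_logb` — **`|log₂ M − (n H(γ_X) + log₂ q · n ∑_σ γ_X(σ) #1's(σ))| ≤ 3^c log₂(n+1)`**.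

Everything is proved; no definitions; no named facts.

## References

* V. Vassilevska Williams, Y. Xu, Z. Xu, R. Zhou, *New bounds for matrix multiplication: from alpha
  to omega*, SODA 2024, arXiv:2307.07970 (held: `paper:arxiv-2307.07970`), Thm. 6.1 and Lemma 3.3.
  [VassilevskaWilliamsXuXuZhou2024]
-/

noncomputable section

open scoped BigOperators
open Finset

namespace Literature.Computability.AlgebraicComplexity

variable {q c n : ℕ}

/-- **VXXZ Thm. 6.1, the size of the matrix multiplication term in entropy form (`ε = 0`)**: for
`n ≥ 1` chunks, `q ≥ 1`, a term `T` with `k_t = 0` data (`i + j = 2c`, `γ_Y(σ) = γ_X(2⃗ − σ)`) and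
`γ_X = k/n` the type of a word supported on shapes of level `i`,
`|log₂ M − (n H(γ_X) + log₂ q · ∑_σ k(σ) #{p | σ_p = 1})| ≤ 3^c · log₂(n+1)` for the number `M` of
`X`-variables of `T^{⊗n}[γ_X, γ_Y, γ_Z]` (`≡ ⟨1, M, 1⟩`, `vxxz2024_thm61_iso`), i.e. the printed
`M = 2^{n(H(γ_X) ± o(1))} · q^{n ∑_σ γ_X(σ) ∑_p [σ_p = 1]}` (`∑_σ k(σ) #1's(σ) = n ∑_σ γ_X(σ) #1's(σ)`).
[cite: VassilevskaWilliamsXuXuZhou2024, Thm. 6.1 and Lemma 3.3] -/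
theorem vxxz2024_thm61_logb (hq : 0 < q) (hn : 0 < n) (T : InterfaceTerm c) (hij : T.i + T.j = 2 * c)
    (hγ : ∀ σ : Fin c → Fin 3, T.γY σ = T.γX (fun p => (σ p).rev)) (k : (Fin c → Fin 3) → ℕ)
    (hk : ∀ σ, (k σ : ℝ) = n * T.γX σ) (hsupp : ∀ σ, k σ ≠ 0 → patternLevel σ = T.i)
    (hsum : ∑ σ, k σ = n) :
    |Real.logb 2 ((mmTermVars q n T 0).card) -
        ((n : ℝ) * shannonEntropy (fun σ => (k σ : ℝ) / n) +
          Real.logb 2 q * ∑ σ, (k σ : ℝ) * ((univ.filter fun p : Fin c => σ p = 1).card : ℝ))| ≤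
      (3 : ℝ) ^ c * Real.logb 2 ((n : ℝ) + 1) := by
  rw [vxxz2024_thm61_card hn T hij hγ k hk hsupp hsum]
  have hmult : (0 : ℝ) < Nat.multinomial univ k := by exact_mod_cast Nat.multinomial_pos _ _
  have hqR : (0 : ℝ) < q := by exact_mod_cast hq
  have hpow : (0 : ℝ) < (q : ℝ) ^ (∑ σ, k σ * (univ.filter fun p : Fin c => σ p = 1).card) := pow_pos hqR _
  push_cast
  rw [Real.logb_mul hmult.ne' hpow.ne', Real.logb_pow]
  push_cast
  have h33 := abs_logb_multinomial_sub_le k hsum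
  have hcard : (Fintype.card (Fin c → Fin 3) : ℝ) = (3 : ℝ) ^ c := by
    rw [Fintype.card_fun, Fintype.card_fin, Fintype.card_fin]; push_cast; ring
  rw [hcard] at h33
  have e : Real.logb 2 (Nat.multinomial univ k) + (∑ σ, (k σ : ℝ) * ((univ.filter fun p : Fin c => σ p = 1).card : ℝ)) * Real.logb 2 q -
      ((n : ℝ) * shannonEntropy (fun σ => (k σ : ℝ) / n) +
        Real.logb 2 q * ∑ σ, (k σ : ℝ) * ((univ.filter fun p : Fin c => σ p = 1).card : ℝ)) =
      Real.logb 2 (Nat.multinomial univ k) - n * shannonEntropy (fun σ => (k σ : ℝ) / n) := by ring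
  rw [e]
  exact h33

/-- The `q`-exponent in terms of `γ_X`: `∑_σ k(σ) #1's(σ) = n ∑_σ γ_X(σ) #1's(σ)`. [cite: VassilevskaWilliamsXuXuZhou2024, Thm. 6.1 (the exponent n_t ∑_σ γ_X(σ) ∑_p [σ_p = 1])] -/
theorem sum_type_mul_ones_eq (T : InterfaceTerm c) (k : (Fin c → Fin 3) → ℕ) (hk : ∀ σ, (k σ : ℝ) = n * T.γX σ) :
    ∑ σ, (k σ : ℝ) * ((univ.filter fun p : Fin c => σ p = 1).card : ℝ) =
      n * ∑ σ, T.γX σ * ((univ.filter fun p : Fin c => σ p = 1).card : ℝ) := by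
  rw [mul_sum]
  exact sum_congr rfl fun σ _ => by rw [hk σ]; ring

end Literature.Computability.AlgebraicComplexity
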